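import Summits.AnomalousDissipation.AnomalousDissipation.Theorems.SawtoothPulseCascadeK1LocalisedCascadeFamilyStep
import Summits.AnomalousDissipation.AnomalousDissipation.Theorems.SawtoothPulseCascadeK1LocalisedCascadeInputSplit
import Summits.AnomalousDissipation.AnomalousDissipation.Theorems.SawtoothPulseCascadeK1LocalisedCascadeSlotExpansionTwoBranch

/-!
# K1loc, line `Spectral` / SeqCone — helper: THE LEDGER STEP ACROSS ONE HALF-SLOT FOR THE TRUE SOLUTION (S-A∘S-C socket)

Helper file of the prover lane on the crux `K1LocalisedCascade` (stmt-AnomalousDissipation-19491), route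
`SawtoothPulseCascade` (memo v6 §4 S-A/S-C; companion of `…K1LocalisedCascadeLedger`).  The ledger theorem
`…K1Ledger.highModeConcentration_of_ledger` consumes, per half-slot, ONE inequality in energy form for the true classical
cascade scalar `w`:
  `Σ m²|𝓕(w t₁)|² ≤ (√Σ μ²|𝓕(w t₀)|² + ε)² + ζ`                                                              (hstepH / hstepV).
This file produces exactly that shape from the landed bricks, for BOTH strip families at once:
 (1) the tracked-family steps `…K1Slot.sqrt_tsum_symbol_sq_family_step_H` / `_V` for `σ = +1` (cut-offs `X̃⁺ ⊇ X⁺`) and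
     `σ = −1` (`X̃⁻ ⊇ X⁻`): `‖m(D)(X^σ w t₁)‖ ≤ ‖μ(D)(X̃^σ w t₀)‖ + e_σ‖w t₀‖`, each from its abstract per-fibre estimate `hfib^σ`;
 (2) the input split `…K1Slot.sqrt_add_sq_symbol_mul_le_of_partition` (`X̃⁺² + X̃⁻² ≤ 1`, keep-form commutator bounds
     `hcp`, `hcm`): `√(Σ_σ ‖μ(D)(X̃^σ w t₀)‖²) ≤ ‖μ(D) w t₀‖ + √(E₊²+E₋²)‖w t₀‖`;
 (3) the recombination `…SpectralLeakage.tsum_symbol_sq_add_le_of_bounds` with a cross-term bound `c₁` (`hcross`):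
     `Σ m²|𝓕((X⁺+X⁻) w t₁)|² ≤ Σ_σ (‖μ(D)(X̃^σ w t₀)‖ + e_σ‖w t₀‖)² + 2c₁`;
 (4) a zone bound `hzone`: `Σ m²|𝓕(w t₁)|² ≤ Σ m²|𝓕((X⁺+X⁻) w t₁)|² + ζ` (the part of `w t₁` off the strips, charged as an
     ENERGY — the locality lemma of the energy-ledger redesign; any valid `ζ` may be supplied);
 (5) Minkowski in `ℝ²` (inside `sq_step_of_family_bounds`).
Result (`ledger_step_H`, `ledger_step_V`):
  `Σ m²|𝓕(w t₁)|² ≤ (√Σ μ²|𝓕(w t₀)|² + (√(E₊²+E₋²) + √(e₊²+e₋²))·‖w t₀‖)² + 2c₁ + ζ`,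
`e_σ = E_slot + A_σ + √(2C_σ)`, `E_slot = 2κ·tHalf j·C₂ + 4C₁√(κ·tHalf j/2) + √(γε₁(5 + 6C₁²κ·tHalf j))`.
So each half-slot of the ledger is reduced to four named inputs: `hfib⁺, hfib⁻` (S-B per-fibre data, discharged by
`…SlotFibreMax` + `…SymbolCone`), `hcp, hcm` (keep-form commutators of `X̃^±`, `…SlotPartitionStep`), `hcross` (`c₁`,
`…SpectralCommutator` / `…SlotExpansionTwoBranch`), `hzone` (`ζ`).  No definitions; no statement about the stub.
[cite: BedrossianCotiZelati2017, §2 (energy method in shear coordinates)] [cite: Grafakos2014, Prop. 3.1.2 (5) and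
Prop. 3.2.7 (3)] [problem: turb]
-/

-- `Summit.<Summit>.<Problem>`: single-conjunct summit, the duplicate namespace segment is deliberate.
set_option linter.dupNamespace false

noncomputable section

namespace Summit.AnomalousDissipation.AnomalousDissipation.Theorems.SawtoothPulseCascade.K1Ledger

open MeasureTheory Set Filter Topology UnitAddTorus Function Complex
open scoped ComplexConjugate
open Literature.Analysis Literature.Analysis.FunctionSpaces Literature.Analysis.FunctionSpaces.Torus
open Literature.Analysis.FluidPDE.ShearStage
open Literature.Analysis.FluidPDE.SawtoothCascade Literature.Analysis.FluidPDE.SawtoothCascade.CascadeParams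
open Summit.AnomalousDissipation.AnomalousDissipation.Theorems.SawtoothPulseCascade.SpectralLeakage
open Summit.AnomalousDissipation.AnomalousDissipation.Theorems.SawtoothPulseCascade.K1Slot

/-! ## §1 Arithmetic: two families, split and recombined, in energy form -/

/-- **The two-family step in energy form.**  If the per-family input energies `Sp, Sm ≥ 0` split as
`√(Sp+Sm) ≤ I + √(E₊²+E₋²)·W`, the recombined output satisfies `SY ≤ (√Sp + e₊W)² + (√Sm + e₋W)² + 2c`, and the full
output is `S ≤ SY + ζ`, then `S ≤ (I + (√(E₊²+E₋²) + √(e₊²+e₋²))·W)² + 2c + ζ` (`W ≥ 0`). [folklore] -/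
theorem sq_step_of_family_bounds {S SY Sp Sm I W Ep Em ep em c ζ : ℝ} (hSp : 0 ≤ Sp) (hSm : 0 ≤ Sm) (hW : 0 ≤ W)
    (hsplit : Real.sqrt (Sp + Sm) ≤ I + Real.sqrt (Ep ^ 2 + Em ^ 2) * W)
    (hrec : SY ≤ (Real.sqrt Sp + ep * W) ^ 2 + (Real.sqrt Sm + em * W) ^ 2 + 2 * c) (hzone : S ≤ SY + ζ) :
    S ≤ (I + (Real.sqrt (Ep ^ 2 + Em ^ 2) + Real.sqrt (ep ^ 2 + em ^ 2)) * W) ^ 2 + 2 * c + ζ := by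
  -- Minkowski in `ℝ²` (via Cauchy–Schwarz `ac + be ≤ √(a²+b²)√(c²+e²)`, Lagrange's identity)
  have hmink : (Real.sqrt Sp + ep * W) ^ 2 + (Real.sqrt Sm + em * W) ^ 2 ≤
      (Real.sqrt (Sp + Sm) + Real.sqrt ((ep * W) ^ 2 + (em * W) ^ 2)) ^ 2 := by
    have ha := Real.sq_sqrt hSp
    have hb := Real.sq_sqrt hSm
    have hcs : Real.sqrt Sp * (ep * W) + Real.sqrt Sm * (em * W) ≤
        Real.sqrt (Sp + Sm) * Real.sqrt ((ep * W) ^ 2 + (em * W) ^ 2) := by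
      rw [← Real.sqrt_mul (by positivity)]
      refine Real.le_sqrt_of_sq_le ?_
      nlinarith [sq_nonneg (Real.sqrt Sp * (em * W) - Real.sqrt Sm * (ep * W)), ha, hb]
    have hc := Real.sq_sqrt (add_nonneg hSp hSm)
    have he := Real.sq_sqrt (add_nonneg (sq_nonneg (ep * W)) (sq_nonneg (em * W)))
    nlinarith [hcs, ha, hb, hc, he]
  have hW2 : Real.sqrt ((ep * W) ^ 2 + (em * W) ^ 2) = Real.sqrt (ep ^ 2 + em ^ 2) * W := by
    rw [show (ep * W) ^ 2 + (em * W) ^ 2 = (ep ^ 2 + em ^ 2) * W ^ 2 by ring,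
      Real.sqrt_mul (by positivity), Real.sqrt_sq hW]
  rw [hW2] at hmink
  have hs0 : 0 ≤ Real.sqrt (Sp + Sm) + Real.sqrt (ep ^ 2 + em ^ 2) * W := by positivity
  have hle : Real.sqrt (Sp + Sm) + Real.sqrt (ep ^ 2 + em ^ 2) * W ≤
      I + (Real.sqrt (Ep ^ 2 + Em ^ 2) + Real.sqrt (ep ^ 2 + em ^ 2)) * W := by linarith
  have hsq := pow_le_pow_left₀ hs0 hle 2
  linarith

/-- A weighted energy `Σ μ²|𝓕f|²` of a real function is non-negative (termwise). [cite: Grafakos2014, Prop. 3.2.7 (3)] -/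
theorem tsum_symbol_sq_nonneg' {d : Type*} [Fintype d] (f : UnitAddTorus d → ℝ) (μ : (d → ℤ) → ℝ) :
    0 ≤ ∑' k, μ k ^ 2 * ‖mFourierCoeff (fun x => (f x : ℂ)) k‖ ^ 2 :=
  tsum_nonneg fun k => by positivity

/-! ## §2 The H half-slot -/

section Cascade

variable (P : CascadeParams)

/-- On the circle, `X̃⁺² + X̃⁻² ≤ 1` for the lifted complex cut-offs. [folklore] -/
theorem norm_sq_onCircle_add_le {Xsp Xsm : ShearProfile} (hpart : ∀ y, Xsp y ^ 2 + Xsm y ^ 2 ≤ 1) (b : UnitAddCircle) :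
    ‖(Xsp.onCircle b : ℂ)‖ ^ 2 + ‖(Xsm.onCircle b : ℂ)‖ ^ 2 ≤ 1 := by
  obtain ⟨y, hy⟩ := QuotientAddGroup.mk_surjective b
  rw [← hy, ShearProfile.onCircle_coe, ShearProfile.onCircle_coe, Complex.norm_real, Complex.norm_real,
    Real.norm_eq_abs, Real.norm_eq_abs, sq_abs, sq_abs]
  exact hpart y

/-- **The ledger step across the H half-slot of phase `j` for the true solution** (both strip families; abstract per-fibre
data, keep-form input commutators, cross-term and zone bounds as named inputs).  Data: the profile derivative `Q = U_j′`;
slot-lemma cut-offs `X̃^σ = Xs^σ` (derivative profiles `Xsd^σ`, `|X̃^σ| ≤ 1`, `|X̃^σ′| ≤ C₁`, `|X̃^σ″| ≤ C₂`, flatness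
`|U_j′ − σ| ≤ ε₁` wherever `X̃^σ ≠ 0` or `X̃^σ′ ≠ 0`, `γε₁ ≤ 1`, and `X̃⁺² + X̃⁻² ≤ 1`); un-gauging cut-offs `X^σ` with
`X^σ·X̃^σ = X^σ`; a zero profile `Z`; a classical cascade scalar `w` on `[0,1)`; the old symbol `μ` (`|μ| ≤ 1`), the new symbol
`m` (`|m| ≤ M`); the per-fibre un-gauging estimates `hfib^σ` (constants `A_σ, C_σ`); the keep-form commutator bounds
`hcp, hcm` of `X̃^±` against `μ(D)` (constants `E_±`, the shape of `…K1Slot.sqrt_add_sq_symbol_mul_le_of_partition`); a bound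
`c₁` on the `m²`-weighted cross term of `X⁺w(t₁)` and `X⁻w(t₁)`; and a zone bound `ζ`:
`Σ m²|𝓕(w t₁)|² ≤ Σ m²|𝓕((X⁺+X⁻)(x₁) w t₁)|² + ζ`.  Then, with `t₀ = tStart j`, `t₁ = t₀ + tHalf j`,
`E_slot = 2κ·tHalf j·C₂ + 4C₁√(κ·tHalf j/2) + √(γε₁(5 + 6C₁²κ·tHalf j))`, `e_σ = E_slot + A_σ + √(2C_σ)`:
`Σ m²|𝓕(w t₁)|² ≤ (√Σ μ²|𝓕(w t₀)|² + (√(E₊²+E₋²) + √(e₊²+e₋²))·‖w t₀‖)² + 2c₁ + ζ` — the hypothesis `hstepH` of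
`…K1Ledger.highModeConcentration_of_ledger` at phase `j`.
[cite: BedrossianCotiZelati2017, §2] [cite: Grafakos2014, Prop. 3.1.2 (5) and Prop. 3.2.7 (3)] -/
theorem ledger_step_H (hγ : 0 ≤ P.γ) (hδ₀ : 0 < P.δ₀) (hd : 0 < P.d) (j : ℕ)
    (Q : ShearProfile) (hQ : ∀ y, Q y = deriv (P.U j) y)
    (Xsp Xspd Xp Xsm Xsmd Xm Z : ShearProfile) (hXspd : ∀ y, Xspd y = deriv Xsp y) (hXsmd : ∀ y, Xsmd y = deriv Xsm y)
    {κ ε₁ C₁ C₂ : ℝ} (hκ : 0 ≤ κ) (hε₁ : 0 ≤ ε₁) (hγε : P.γ * ε₁ ≤ 1)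
    (hXsp1 : ∀ y, |Xsp y| ≤ 1) (hXsm1 : ∀ y, |Xsm y| ≤ 1) (hpart : ∀ y, Xsp y ^ 2 + Xsm y ^ 2 ≤ 1)
    (hC₁p : ∀ y, |Xspd y| ≤ C₁) (hC₁m : ∀ y, |Xsmd y| ≤ C₁)
    (hC₂p : ∀ y, |deriv Xspd y| ≤ C₂) (hC₂m : ∀ y, |deriv Xsmd y| ≤ C₂)
    (hflat_p : ∀ y, Xsp y ≠ 0 ∨ Xspd y ≠ 0 → |Q y - 1| ≤ ε₁)
    (hflat_m : ∀ y, Xsm y ≠ 0 ∨ Xsmd y ≠ 0 → |Q y - (-1)| ≤ ε₁)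
    (hXXs_p : ∀ y, Xp y * Xsp y = Xp y) (hXXs_m : ∀ y, Xm y * Xsm y = Xm y) (hZ : ∀ y, Z y = 0)
    {w : ℝ → UnitAddTorus (Fin 2) → ℝ} (hw : FluidPDE.Torus.IsClassicalScalarTransportOn (Ico 0 1) κ P.field w)
    {μ m : (Fin 2 → ℤ) → ℝ} (hμ1 : ∀ k, |μ k| ≤ 1) {M : ℝ} (hmM : ∀ k, |m k| ≤ M)
    {Ap Cp Am Cm : ℝ} (hAp : 0 ≤ Ap) (hCp : 0 ≤ Cp) (hAm : 0 ≤ Am) (hCm : 0 ≤ Cm)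
    (hfib_p : ∀ n : ℤ, ∀ G : UnitAddTorus (Fin 2) → ℂ, IsSmooth G → (∀ k, mFourierCoeff G k ≠ 0 → k 0 = n) →
      ∑' k, m k ^ 2 * ‖mFourierCoeff (fun x => ((Xp.onCircle (x 1) : ℂ) + Z.onCircle (x 1)) *
          G (shearMap 0 1 (amp ⟨P.U j, P.U_periodic j, P.contDiff_U (P.δ_pos hδ₀ hd j)⟩ P.γ) x)) k‖ ^ 2 ≤
        (Real.sqrt (∑' k, μ k ^ 2 * ‖mFourierCoeff G k‖ ^ 2) + Ap * Real.sqrt (∫ x, ‖G x‖ ^ 2)) ^ 2 +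
          2 * Cp * ∫ x, ‖G x‖ ^ 2)
    (hfib_m : ∀ n : ℤ, ∀ G : UnitAddTorus (Fin 2) → ℂ, IsSmooth G → (∀ k, mFourierCoeff G k ≠ 0 → k 0 = n) →
      ∑' k, m k ^ 2 * ‖mFourierCoeff (fun x => ((Xm.onCircle (x 1) : ℂ) + Z.onCircle (x 1)) *
          G (shearMap 0 1 (amp ⟨P.U j, P.U_periodic j, P.contDiff_U (P.δ_pos hδ₀ hd j)⟩ P.γ) x)) k‖ ^ 2 ≤
        (Real.sqrt (∑' k, μ k ^ 2 * ‖mFourierCoeff G k‖ ^ 2) + Am * Real.sqrt (∫ x, ‖G x‖ ^ 2)) ^ 2 +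
          2 * Cm * ∫ x, ‖G x‖ ^ 2)
    {Ep Em : ℝ} (hEp : 0 ≤ Ep) (hEm : 0 ≤ Em)
    (hcp : Real.sqrt (∑' k, μ k ^ 2 * ‖mFourierCoeff (fun x => (Xsp.onCircle (x 1) : ℂ) * (w (tStart j) x : ℂ)) k‖ ^ 2) ≤
      Real.sqrt (∫ x, ‖(Xsp.onCircle (x 1) : ℂ) *
          fourierSynth (fun k => (μ k : ℂ) * mFourierCoeff (fun x => (w (tStart j) x : ℂ)) k) x‖ ^ 2) +
        Ep * Real.sqrt (∫ x, ‖(w (tStart j) x : ℂ)‖ ^ 2))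
    (hcm : Real.sqrt (∑' k, μ k ^ 2 * ‖mFourierCoeff (fun x => (Xsm.onCircle (x 1) : ℂ) * (w (tStart j) x : ℂ)) k‖ ^ 2) ≤
      Real.sqrt (∫ x, ‖(Xsm.onCircle (x 1) : ℂ) *
          fourierSynth (fun k => (μ k : ℂ) * mFourierCoeff (fun x => (w (tStart j) x : ℂ)) k) x‖ ^ 2) +
        Em * Real.sqrt (∫ x, ‖(w (tStart j) x : ℂ)‖ ^ 2))
    {c₁ : ℝ} (hcross : ‖∑' k, ((m k ^ 2 : ℝ) : ℂ) *
        mFourierCoeff (fun x => ((Xp.onCircle (x 1) * w (tStart j + tHalf j) x : ℝ) : ℂ)) k *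
          conj (mFourierCoeff (fun x => ((Xm.onCircle (x 1) * w (tStart j + tHalf j) x : ℝ) : ℂ)) k)‖ ≤ c₁)
    {ζ : ℝ} (hzone : ∑' k, m k ^ 2 * ‖mFourierCoeff (fun x => (w (tStart j + tHalf j) x : ℂ)) k‖ ^ 2 ≤
      ∑' k, m k ^ 2 * ‖mFourierCoeff (fun x =>
          (((Xp.onCircle (x 1) + Xm.onCircle (x 1)) * w (tStart j + tHalf j) x : ℝ) : ℂ)) k‖ ^ 2 + ζ) :
    ∑' k, m k ^ 2 * ‖mFourierCoeff (fun x => (w (tStart j + tHalf j) x : ℂ)) k‖ ^ 2 ≤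
      (Real.sqrt (∑' k, μ k ^ 2 * ‖mFourierCoeff (fun x => (w (tStart j) x : ℂ)) k‖ ^ 2) +
          (Real.sqrt (Ep ^ 2 + Em ^ 2) +
              Real.sqrt ((2 * κ * tHalf j * C₂ + 4 * C₁ * Real.sqrt (κ * tHalf j / 2) +
                    Real.sqrt (P.γ * ε₁ * (5 + 6 * C₁ ^ 2 * κ * tHalf j)) + Ap + Real.sqrt (2 * Cp)) ^ 2 +
                (2 * κ * tHalf j * C₂ + 4 * C₁ * Real.sqrt (κ * tHalf j / 2) +
                    Real.sqrt (P.γ * ε₁ * (5 + 6 * C₁ ^ 2 * κ * tHalf j)) + Am + Real.sqrt (2 * Cm)) ^ 2)) *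
            Real.sqrt (FluidPDE.Torus.scalarL2Sq (w (tStart j)))) ^ 2 +
        2 * c₁ + ζ := by
  set t₀ : ℝ := tStart j with ht₀
  set t₁ : ℝ := tStart j + tHalf j with ht₁
  set Es : ℝ := 2 * κ * tHalf j * C₂ + 4 * C₁ * Real.sqrt (κ * tHalf j / 2) +
    Real.sqrt (P.γ * ε₁ * (5 + 6 * C₁ ^ 2 * κ * tHalf j)) with hEs
  have hC₁0 : 0 ≤ C₁ := (abs_nonneg _).trans (hC₁p 0)
  have hC₂0 : 0 ≤ C₂ := (abs_nonneg _).trans (hC₂p 0)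
  have htH := tHalf_pos j
  have hEs0 : 0 ≤ Es := by rw [hEs]; positivity
  -- times and slices
  have ht₀mem : t₀ ∈ Ico (0 : ℝ) 1 := ⟨tStart_nonneg j, tStart_lt_one j⟩
  have ht₁mem : t₁ ∈ Ico (0 : ℝ) 1 := ⟨by rw [ht₁]; linarith [tStart_nonneg j], tStart_add_tHalf_lt_one j⟩
  have hw₀ : IsSmooth (w t₀) := hw.smooth_scalar.isSmooth_slice ht₀mem
  have hw₁ : IsSmooth (w t₁) := hw.smooth_scalar.isSmooth_slice ht₁mem
  -- (1) the two tracked-family steps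
  have hOp := sqrt_tsum_symbol_sq_family_step_H P hγ hδ₀ hd j Q Xsp Xspd hQ hXspd (σ := 1) hκ hε₁ hγε hXsp1 hC₁p hC₂p
    hflat_p Xp Z hXXs_p hZ hw hμ1 hmM hAp hCp hfib_p
  have hOm := sqrt_tsum_symbol_sq_family_step_H P hγ hδ₀ hd j Q Xsm Xsmd hQ hXsmd (σ := -1) hκ hε₁ hγε hXsm1 hC₁m hC₂m
    hflat_m Xm Z hXXs_m hZ hw hμ1 hmM hAm hCm hfib_m
  rw [← hEs] at hOp hOm
  -- (2) the input split
  set F : UnitAddTorus (Fin 2) → ℂ := fun x => (w t₀ x : ℂ) with hF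
  have hFc : Continuous F := continuous_ofReal.comp hw₀.continuous
  have hFs : Summable fun k => ‖mFourierCoeff F k‖ := hw₀.ofReal_comp.rapidDecay_mFourierCoeff.summable_norm
  have hΘp : Continuous fun x : UnitAddTorus (Fin 2) => (Xsp.onCircle (x 1) : ℂ) :=
    continuous_ofReal.comp (isSmooth_onCircle_comp' Xsp 1).continuous
  have hΘm : Continuous fun x : UnitAddTorus (Fin 2) => (Xsm.onCircle (x 1) : ℂ) :=
    continuous_ofReal.comp (isSmooth_onCircle_comp' Xsm 1).continuous
  have hpart' : ∀ x : UnitAddTorus (Fin 2), ‖(Xsp.onCircle (x 1) : ℂ)‖ ^ 2 + ‖(Xsm.onCircle (x 1) : ℂ)‖ ^ 2 ≤ 1 :=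
    fun x => norm_sq_onCircle_add_le hpart (x 1)
  have hsplit := sqrt_add_sq_symbol_mul_le_of_partition (F := F) hFs hΘp hΘm hpart' hμ1 hEp hEm hcp hcm
  -- identify the pieces of the split with the inputs of the family steps
  have hFp : (fun x : UnitAddTorus (Fin 2) => (Xsp.onCircle (x 1) : ℂ) * F x) =
      fun x => ((Xsp.onCircle (x 1) * w t₀ x : ℝ) : ℂ) := by
    funext x; simp only [hF, Complex.ofReal_mul]
  have hFm : (fun x : UnitAddTorus (Fin 2) => (Xsm.onCircle (x 1) : ℂ) * F x) =
      fun x => ((Xsm.onCircle (x 1) * w t₀ x : ℝ) : ℂ) := by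
    funext x; simp only [hF, Complex.ofReal_mul]
  have hFL2 : ∫ x, ‖F x‖ ^ 2 = FluidPDE.Torus.scalarL2Sq (w t₀) := by
    unfold FluidPDE.Torus.scalarL2Sq
    refine integral_congr_ae (ae_of_all _ fun x => ?_)
    simp only [hF, Complex.norm_real, Real.norm_eq_abs, sq_abs]
  rw [hFp, hFm, hFL2] at hsplit
  -- (3) recombination of the two outputs
  have hPc : Continuous fun x : UnitAddTorus (Fin 2) => ((Xp.onCircle (x 1) * w t₁ x : ℝ) : ℂ) :=
    continuous_ofReal.comp ((isSmooth_onCircle_comp' Xp 1).continuous.mul hw₁.continuous)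
  have hQc : Continuous fun x : UnitAddTorus (Fin 2) => ((Xm.onCircle (x 1) * w t₁ x : ℝ) : ℂ) :=
    continuous_ofReal.comp ((isSmooth_onCircle_comp' Xm 1).continuous.mul hw₁.continuous)
  have hrec := tsum_symbol_sq_add_le_of_bounds hPc hQc hmM hOp hOm hcross
  have hsum : (fun x : UnitAddTorus (Fin 2) => ((Xp.onCircle (x 1) * w t₁ x : ℝ) : ℂ) + ((Xm.onCircle (x 1) * w t₁ x : ℝ) : ℂ)) =
      fun x => (((Xp.onCircle (x 1) + Xm.onCircle (x 1)) * w t₁ x : ℝ) : ℂ) := by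
    funext x; push_cast; ring
  rw [hsum] at hrec
  -- (4)+(5) zone bound and arithmetic
  set W : ℝ := Real.sqrt (FluidPDE.Torus.scalarL2Sq (w t₀)) with hW
  exact sq_step_of_family_bounds (K1Ledger.tsum_symbol_sq_nonneg' _ _) (K1Ledger.tsum_symbol_sq_nonneg' _ _)
    (Real.sqrt_nonneg _) hsplit hrec hzone

/-! ## §3 The V half-slot -/

/-- **The ledger step across the V half-slot of phase `j` for the true solution** (indices swapped: the cut-offs read `x₀`, the
fibres are `k₁ = n`, `Φ = shearMap 1 0 (amp U_j γ)`, `t₀ = tStart (j + 1)`, `t₁ = tStart (j+1)`; otherwise as the H version) (both strip families; abstract per-fibre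
data, keep-form input commutators, cross-term and zone bounds as named inputs).  Data: the profile derivative `Q = U_j′`;
slot-lemma cut-offs `X̃^σ = Xs^σ` (derivative profiles `Xsd^σ`, `|X̃^σ| ≤ 1`, `|X̃^σ′| ≤ C₁`, `|X̃^σ″| ≤ C₂`, flatness
`|U_j′ − σ| ≤ ε₁` wherever `X̃^σ ≠ 0` or `X̃^σ′ ≠ 0`, `γε₁ ≤ 1`, and `X̃⁺² + X̃⁻² ≤ 1`); un-gauging cut-offs `X^σ` with
`X^σ·X̃^σ = X^σ`; a zero profile `Z`; a classical cascade scalar `w` on `[0,1)`; the old symbol `μ` (`|μ| ≤ 1`), the new symbol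
`m` (`|m| ≤ M`); the per-fibre un-gauging estimates `hfib^σ` (constants `A_σ, C_σ`); the keep-form commutator bounds
`hcp, hcm` of `X̃^±` against `μ(D)` (constants `E_±`, the shape of `…K1Slot.sqrt_add_sq_symbol_mul_le_of_partition`); a bound
`c₁` on the `m²`-weighted cross term of `X⁺w(t₁)` and `X⁻w(t₁)`; and a zone bound `ζ`:
`Σ m²|𝓕(w t₁)|² ≤ Σ m²|𝓕((X⁺+X⁻)(x₀) w t₁)|² + ζ`.  Then, with `t₀ = tStart (j + 1)`, `t₁ = tStart (j+1)`,
`E_slot = 2κ·tHalf j·C₂ + 4C₁√(κ·tHalf j/2) + √(γε₁(5 + 6C₁²κ·tHalf j))`, `e_σ = E_slot + A_σ + √(2C_σ)`: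
`Σ m²|𝓕(w t₁)|² ≤ (√Σ μ²|𝓕(w t₀)|² + (√(E₊²+E₋²) + √(e₊²+e₋²))·‖w t₀‖)² + 2c₁ + ζ` — the hypothesis `hstepV` of
`…K1Ledger.highModeConcentration_of_ledger` at phase `j`.
[cite: BedrossianCotiZelati2017, §2] [cite: Grafakos2014, Prop. 3.1.2 (5) and Prop. 3.2.7 (3)] -/
theorem ledger_step_V (hγ : 0 ≤ P.γ) (hδ₀ : 0 < P.δ₀) (hd : 0 < P.d) (j : ℕ)
    (Q : ShearProfile) (hQ : ∀ y, Q y = deriv (P.U j) y)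
    (Xsp Xspd Xp Xsm Xsmd Xm Z : ShearProfile) (hXspd : ∀ y, Xspd y = deriv Xsp y) (hXsmd : ∀ y, Xsmd y = deriv Xsm y)
    {κ ε₁ C₁ C₂ : ℝ} (hκ : 0 ≤ κ) (hε₁ : 0 ≤ ε₁) (hγε : P.γ * ε₁ ≤ 1)
    (hXsp1 : ∀ y, |Xsp y| ≤ 1) (hXsm1 : ∀ y, |Xsm y| ≤ 1) (hpart : ∀ y, Xsp y ^ 2 + Xsm y ^ 2 ≤ 1)
    (hC₁p : ∀ y, |Xspd y| ≤ C₁) (hC₁m : ∀ y, |Xsmd y| ≤ C₁)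
    (hC₂p : ∀ y, |deriv Xspd y| ≤ C₂) (hC₂m : ∀ y, |deriv Xsmd y| ≤ C₂)
    (hflat_p : ∀ y, Xsp y ≠ 0 ∨ Xspd y ≠ 0 → |Q y - 1| ≤ ε₁)
    (hflat_m : ∀ y, Xsm y ≠ 0 ∨ Xsmd y ≠ 0 → |Q y - (-1)| ≤ ε₁)
    (hXXs_p : ∀ y, Xp y * Xsp y = Xp y) (hXXs_m : ∀ y, Xm y * Xsm y = Xm y) (hZ : ∀ y, Z y = 0)
    {w : ℝ → UnitAddTorus (Fin 2) → ℝ} (hw : FluidPDE.Torus.IsClassicalScalarTransportOn (Ico 0 1) κ P.field w)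
    {μ m : (Fin 2 → ℤ) → ℝ} (hμ1 : ∀ k, |μ k| ≤ 1) {M : ℝ} (hmM : ∀ k, |m k| ≤ M)
    {Ap Cp Am Cm : ℝ} (hAp : 0 ≤ Ap) (hCp : 0 ≤ Cp) (hAm : 0 ≤ Am) (hCm : 0 ≤ Cm)
    (hfib_p : ∀ n : ℤ, ∀ G : UnitAddTorus (Fin 2) → ℂ, IsSmooth G → (∀ k, mFourierCoeff G k ≠ 0 → k 1 = n) →
      ∑' k, m k ^ 2 * ‖mFourierCoeff (fun x => ((Xp.onCircle (x 0) : ℂ) + Z.onCircle (x 0)) *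
          G (shearMap 1 0 (amp ⟨P.U j, P.U_periodic j, P.contDiff_U (P.δ_pos hδ₀ hd j)⟩ P.γ) x)) k‖ ^ 2 ≤
        (Real.sqrt (∑' k, μ k ^ 2 * ‖mFourierCoeff G k‖ ^ 2) + Ap * Real.sqrt (∫ x, ‖G x‖ ^ 2)) ^ 2 +
          2 * Cp * ∫ x, ‖G x‖ ^ 2)
    (hfib_m : ∀ n : ℤ, ∀ G : UnitAddTorus (Fin 2) → ℂ, IsSmooth G → (∀ k, mFourierCoeff G k ≠ 0 → k 1 = n) →
      ∑' k, m k ^ 2 * ‖mFourierCoeff (fun x => ((Xm.onCircle (x 0) : ℂ) + Z.onCircle (x 0)) *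
          G (shearMap 1 0 (amp ⟨P.U j, P.U_periodic j, P.contDiff_U (P.δ_pos hδ₀ hd j)⟩ P.γ) x)) k‖ ^ 2 ≤
        (Real.sqrt (∑' k, μ k ^ 2 * ‖mFourierCoeff G k‖ ^ 2) + Am * Real.sqrt (∫ x, ‖G x‖ ^ 2)) ^ 2 +
          2 * Cm * ∫ x, ‖G x‖ ^ 2)
    {Ep Em : ℝ} (hEp : 0 ≤ Ep) (hEm : 0 ≤ Em)
    (hcp : Real.sqrt (∑' k, μ k ^ 2 * ‖mFourierCoeff (fun x => (Xsp.onCircle (x 0) : ℂ) * (w (tStart j + tHalf j) x : ℂ)) k‖ ^ 2) ≤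
      Real.sqrt (∫ x, ‖(Xsp.onCircle (x 0) : ℂ) *
          fourierSynth (fun k => (μ k : ℂ) * mFourierCoeff (fun x => (w (tStart j + tHalf j) x : ℂ)) k) x‖ ^ 2) +
        Ep * Real.sqrt (∫ x, ‖(w (tStart j + tHalf j) x : ℂ)‖ ^ 2))
    (hcm : Real.sqrt (∑' k, μ k ^ 2 * ‖mFourierCoeff (fun x => (Xsm.onCircle (x 0) : ℂ) * (w (tStart j + tHalf j) x : ℂ)) k‖ ^ 2) ≤
      Real.sqrt (∫ x, ‖(Xsm.onCircle (x 0) : ℂ) *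
          fourierSynth (fun k => (μ k : ℂ) * mFourierCoeff (fun x => (w (tStart j + tHalf j) x : ℂ)) k) x‖ ^ 2) +
        Em * Real.sqrt (∫ x, ‖(w (tStart j + tHalf j) x : ℂ)‖ ^ 2))
    {c₁ : ℝ} (hcross : ‖∑' k, ((m k ^ 2 : ℝ) : ℂ) *
        mFourierCoeff (fun x => ((Xp.onCircle (x 0) * w (tStart (j + 1)) x : ℝ) : ℂ)) k *
          conj (mFourierCoeff (fun x => ((Xm.onCircle (x 0) * w (tStart (j + 1)) x : ℝ) : ℂ)) k)‖ ≤ c₁)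
    {ζ : ℝ} (hzone : ∑' k, m k ^ 2 * ‖mFourierCoeff (fun x => (w (tStart (j + 1)) x : ℂ)) k‖ ^ 2 ≤
      ∑' k, m k ^ 2 * ‖mFourierCoeff (fun x =>
          (((Xp.onCircle (x 0) + Xm.onCircle (x 0)) * w (tStart (j + 1)) x : ℝ) : ℂ)) k‖ ^ 2 + ζ) :
    ∑' k, m k ^ 2 * ‖mFourierCoeff (fun x => (w (tStart (j + 1)) x : ℂ)) k‖ ^ 2 ≤
      (Real.sqrt (∑' k, μ k ^ 2 * ‖mFourierCoeff (fun x => (w (tStart j + tHalf j) x : ℂ)) k‖ ^ 2) +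
          (Real.sqrt (Ep ^ 2 + Em ^ 2) +
              Real.sqrt ((2 * κ * tHalf j * C₂ + 4 * C₁ * Real.sqrt (κ * tHalf j / 2) +
                    Real.sqrt (P.γ * ε₁ * (5 + 6 * C₁ ^ 2 * κ * tHalf j)) + Ap + Real.sqrt (2 * Cp)) ^ 2 +
                (2 * κ * tHalf j * C₂ + 4 * C₁ * Real.sqrt (κ * tHalf j / 2) +
                    Real.sqrt (P.γ * ε₁ * (5 + 6 * C₁ ^ 2 * κ * tHalf j)) + Am + Real.sqrt (2 * Cm)) ^ 2)) *
            Real.sqrt (FluidPDE.Torus.scalarL2Sq (w (tStart j + tHalf j)))) ^ 2 +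
        2 * c₁ + ζ := by
  set t₀ : ℝ := tStart j + tHalf j with ht₀
  set t₁ : ℝ := tStart (j + 1) with ht₁
  set Es : ℝ := 2 * κ * tHalf j * C₂ + 4 * C₁ * Real.sqrt (κ * tHalf j / 2) +
    Real.sqrt (P.γ * ε₁ * (5 + 6 * C₁ ^ 2 * κ * tHalf j)) with hEs
  have hC₁0 : 0 ≤ C₁ := (abs_nonneg _).trans (hC₁p 0)
  have hC₂0 : 0 ≤ C₂ := (abs_nonneg _).trans (hC₂p 0)
  have htH := tHalf_pos j
  have hEs0 : 0 ≤ Es := by rw [hEs]; positivity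
  -- times and slices
  have ht₀mem : t₀ ∈ Ico (0 : ℝ) 1 := ⟨by rw [ht₀]; linarith [tStart_nonneg j], tStart_add_tHalf_lt_one j⟩
  have ht₁mem : t₁ ∈ Ico (0 : ℝ) 1 := ⟨tStart_nonneg (j + 1), tStart_lt_one (j + 1)⟩
  have hw₀ : IsSmooth (w t₀) := hw.smooth_scalar.isSmooth_slice ht₀mem
  have hw₁ : IsSmooth (w t₁) := hw.smooth_scalar.isSmooth_slice ht₁mem
  -- (1) the two tracked-family steps
  have hOp := sqrt_tsum_symbol_sq_family_step_V P hγ hδ₀ hd j Q Xsp Xspd hQ hXspd (σ := 1) hκ hε₁ hγε hXsp1 hC₁p hC₂p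
    hflat_p Xp Z hXXs_p hZ hw hμ1 hmM hAp hCp hfib_p
  have hOm := sqrt_tsum_symbol_sq_family_step_V P hγ hδ₀ hd j Q Xsm Xsmd hQ hXsmd (σ := -1) hκ hε₁ hγε hXsm1 hC₁m hC₂m
    hflat_m Xm Z hXXs_m hZ hw hμ1 hmM hAm hCm hfib_m
  rw [← hEs] at hOp hOm
  -- (2) the input split
  set F : UnitAddTorus (Fin 2) → ℂ := fun x => (w t₀ x : ℂ) with hF
  have hFc : Continuous F := continuous_ofReal.comp hw₀.continuous
  have hFs : Summable fun k => ‖mFourierCoeff F k‖ := hw₀.ofReal_comp.rapidDecay_mFourierCoeff.summable_norm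
  have hΘp : Continuous fun x : UnitAddTorus (Fin 2) => (Xsp.onCircle (x 0) : ℂ) :=
    continuous_ofReal.comp (isSmooth_onCircle_comp' Xsp 0).continuous
  have hΘm : Continuous fun x : UnitAddTorus (Fin 2) => (Xsm.onCircle (x 0) : ℂ) :=
    continuous_ofReal.comp (isSmooth_onCircle_comp' Xsm 0).continuous
  have hpart' : ∀ x : UnitAddTorus (Fin 2), ‖(Xsp.onCircle (x 0) : ℂ)‖ ^ 2 + ‖(Xsm.onCircle (x 0) : ℂ)‖ ^ 2 ≤ 1 :=
    fun x => norm_sq_onCircle_add_le hpart (x 0)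
  have hsplit := sqrt_add_sq_symbol_mul_le_of_partition (F := F) hFs hΘp hΘm hpart' hμ1 hEp hEm hcp hcm
  -- identify the pieces of the split with the inputs of the family steps
  have hFp : (fun x : UnitAddTorus (Fin 2) => (Xsp.onCircle (x 0) : ℂ) * F x) =
      fun x => ((Xsp.onCircle (x 0) * w t₀ x : ℝ) : ℂ) := by
    funext x; simp only [hF, Complex.ofReal_mul]
  have hFm : (fun x : UnitAddTorus (Fin 2) => (Xsm.onCircle (x 0) : ℂ) * F x) =
      fun x => ((Xsm.onCircle (x 0) * w t₀ x : ℝ) : ℂ) := by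
    funext x; simp only [hF, Complex.ofReal_mul]
  have hFL2 : ∫ x, ‖F x‖ ^ 2 = FluidPDE.Torus.scalarL2Sq (w t₀) := by
    unfold FluidPDE.Torus.scalarL2Sq
    refine integral_congr_ae (ae_of_all _ fun x => ?_)
    simp only [hF, Complex.norm_real, Real.norm_eq_abs, sq_abs]
  rw [hFp, hFm, hFL2] at hsplit
  -- (3) recombination of the two outputs
  have hPc : Continuous fun x : UnitAddTorus (Fin 2) => ((Xp.onCircle (x 0) * w t₁ x : ℝ) : ℂ) :=
    continuous_ofReal.comp ((isSmooth_onCircle_comp' Xp 0).continuous.mul hw₁.continuous)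
  have hQc : Continuous fun x : UnitAddTorus (Fin 2) => ((Xm.onCircle (x 0) * w t₁ x : ℝ) : ℂ) :=
    continuous_ofReal.comp ((isSmooth_onCircle_comp' Xm 0).continuous.mul hw₁.continuous)
  have hrec := tsum_symbol_sq_add_le_of_bounds hPc hQc hmM hOp hOm hcross
  have hsum : (fun x : UnitAddTorus (Fin 2) => ((Xp.onCircle (x 0) * w t₁ x : ℝ) : ℂ) + ((Xm.onCircle (x 0) * w t₁ x : ℝ) : ℂ)) =
      fun x => (((Xp.onCircle (x 0) + Xm.onCircle (x 0)) * w t₁ x : ℝ) : ℂ) := by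
    funext x; push_cast; ring
  rw [hsum] at hrec
  -- (4)+(5) zone bound and arithmetic
  set W : ℝ := Real.sqrt (FluidPDE.Torus.scalarL2Sq (w t₀)) with hW
  exact sq_step_of_family_bounds (K1Ledger.tsum_symbol_sq_nonneg' _ _) (K1Ledger.tsum_symbol_sq_nonneg' _ _)
    (Real.sqrt_nonneg _) hsplit hrec hzone

end Cascade

end Summit.AnomalousDissipation.AnomalousDissipation.Theorems.SawtoothPulseCascade.K1Ledger
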